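import Summits.AtomisticToContinuum.Crystallization.Theorems.ChartedZeroExcessLayeredLatticeLiouvilleZZZY

/-!
# ChartedZeroExcess · LayeredLatticeLiouville ZZZYA (lens-2 g90 NODE 90b «SIGMA edition», part 1 of 2) — (GL₂)(σ) and (UXᴸ)(σ): the record
# label chain beneath the W2 door re-issued at SYMBOLIC shadow separation `σ`
SIGMA edition (critic row 1612): `σ′ = 27/32` because SEP-SQUEEZE refutes `σ = 17/20` in value (squeezed force-free fcc, n.n. `0.847`); the
`17/20` declarations of the tree stay as history (new names throughout, nothing shadowed).  Route ChartedPlanarOrder, docket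
`stmt-AtomisticToContinuum-26636`, W2 line.  Every dial `σ` beneath the W2 door of record (tree ZZZY `mildCoherentMoatCorePG_W2d_exactWell`) was
the LITERAL `17/20`, inherited through fourteen record instances, while every junction theorem underneath is already `σ`-generic.  This part:
* ZZZYA-1 (GL₂)(σ), hypothesis `2·10⁻⁴ < σ`: `layeredHom_good_of_shadow_sigma`, `exists_ontoChart_of_good_sigma` (`0 < σ`), `placedCrystalChartP_sigma`
  = (CC)(σ), `exists_isBondLabel_of_slabIso_record₂_sigma`, `exists_isBondLabel₂_of_package_sigma`, `bondLabelP₂_of_placedCrystalChartP_sigma`,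
  `bondLabelP₂_sigma` — trees ZZZK / ZZZE / ZZZF / ZZZG verbatim, the literal replaced by `σ`, the one `norm_num` closing `2·10⁻⁴ < 17/20` by `hσ`;
* ZZZYA-2 (UXᴸ)(σ), hypothesis `1/2 ≤ σ`: `labelChain_exit_sigma` (tree ZZZV `labelChain_exit` verbatim; `σ` enters only `bonded_placed_le_twelve`),
  `offTubeBulkExitP_of_labelChain_sigma`, `offTubeBulkExitP_fat_sigma`, `offTubeBondExitP_fat_sigma`, `offTubeRigidGapP_fat_sigma` (trees ZZZV / ZZZU).
Part 2 (file ZZZYB): the doors at symbolic `σ` (single side condition `21/25 < σ`), the repaired door of record at `σ′ = 27/32`, the links.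
0 sorry · import = tree ZZZY only · 0 defs · 12 theorems · no instances/notation/options · zero new mathematics (re-dialling only) · axioms standard. [g90]
-/

noncomputable section
open scoped BigOperators Classical InnerProductSpace RealInnerProductSpace
open MeasureTheory Set Metric Filter Topology
open Literature.Geometry.DiscreteGeometry (IsTwoShellGoodSet fccTwoShellPattern hcpTwoShellPattern card_filter_norm_eq_one_of_twoShellPattern
  norm_of_mem_twoShellPattern)
open Literature.MathematicalPhysics.StatisticalMechanics (lennardJones UniformlyDiscrete card_le_of_separated_of_dist_le)
open Literature.Probability.Process.LocalConfig (finite_inter_of_separated)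

namespace Summit.AtomisticToContinuum.Crystallization.Theorems.ChartedZeroExcessLayeredLatticeLiouville

open Summit.AtomisticToContinuum.Crystallization.Theorems.ChartedPlanarOrderRigidityDoor (E3 IsClean IsCharted atomsIn)
open Summit.AtomisticToContinuum.Crystallization.Theorems.ChartedPlanarOrderDensityDichotomy (μS IsSep)
open Summit.AtomisticToContinuum.Crystallization.Theorems.ChartedPlanarOrderCleanScaleP (IsCleanP IsDoorSetP isCleanP_μS_iff)
open Summit.AtomisticToContinuum.Crystallization.Theorems.ChartedPlanarOrderMesoCut (LayeredHom EnvClose)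
open Summit.AtomisticToContinuum.Crystallization.Theorems.ChartedPlanarOrderDoorLayeredOsc (IsTwoShellAffineGood mem_iff_μS_singleton_ne_zero)
open Summit.AtomisticToContinuum.Crystallization.Theorems.ChartedPlanarOrderCleanStackedIndependent (setOf_μS_ne_zero)

/-! ### ZZZYA-1  (GL₂)(σ): the placed crystal is charted onto and bond-labelled, for every shadow separation `σ > 2·10⁻⁴` -/

section SigmaGL

/-- ★ shadow goodness at symbolic `σ` (`2·10⁻⁴ < σ`): every site of the model crystal of a cool shadow crystal of a CLEAN `H` is `(1/15, 8999/10000, 1)`-good — tree ZZZK `layeredHom_good_of_shadow` with tree ZZZH's generic transfer. [tree ZZZK, re-dialled g90] -/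
theorem layeredHom_good_of_shadow_sigma {σ : ℝ} (hσ : 2 * (1 / 10000 : ℝ) < σ) {H : Set E3} (hH : IsClean (μS H)) {L' : E3 →L[ℝ] E3} {w' : ℤ → E3}
    (hsep : IsSep σ (LayeredHom L' w'))
    (hsh : ∀ x' ∈ LayeredHom L' w', ∃ x ∈ H, EnvClose (1 / 10000) 5 (LayeredHom L' w') x' H x) :
    ∀ x' ∈ LayeredHom L' w', IsTwoShellGoodSet (1 / 15) (8999 / 10000) 1 (LayeredHom L' w') x' := fun x' hx' => by
  obtain ⟨x, hx, hE⟩ := hsh x' hx'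
  have h := isTwoShellGoodSet_of_envClose (θ' := 1 / 15) (by norm_num) (by norm_num) (by norm_num) (by norm_num) (by norm_num) (by norm_num)
    hσ (by norm_num) ((isCleanP_μS_iff (aHi := 1) H).1 hH x hx) hsep hx' hE
  norm_num at h
  exact h

/-- ★★ a `σ`-separated (`σ > 0`) everywhere-good set has an ONTO global Barlow bond chart — tree ZZZK `exists_ontoChart_of_good` verbatim. [tree ZZZK, re-dialled g90] -/
theorem exists_ontoChart_of_good_sigma {σ : ℝ} (hσ : 0 < σ) {Y : Set E3} (hsep : IsSep σ Y)
    (hgood : ∀ y ∈ Y, IsTwoShellGoodSet (1 / 15) (8999 / 10000) 1 Y y) {y₀ : E3} (hy₀ : y₀ ∈ Y) :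
    ∃ (Ψ : ℤ × ℤ × ℤ → E3) (τ : ℤ → Bool), IsBarlowBondChart Y Set.univ Ψ τ ∧ ∀ p ∈ Y, ∃ x, Ψ x = p := by
  have h0 : (0 : E3) ∈ (fun p => p + -y₀) '' Y := ⟨y₀, hy₀, add_neg_cancel y₀⟩
  have hgood₀ : ∀ q ∈ (fun p => p + -y₀) '' Y, IsTwoShellGoodSet (1 / 15) (8999 / 10000) (103 / 100) ((fun p => p + -y₀) '' Y) q := by
    rintro q ⟨q₀, hq₀, rfl⟩
    exact (isTwoShellGoodSet_translate (-y₀) (hgood q₀ hq₀)).mono_window le_rfl (by norm_num)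
  have hud : UniformlyDiscrete ((fun p => p + -y₀) '' Y) := uniformlyDiscrete_of_isSep hσ (isSep_translate (-y₀) hsep)
  have hch : IsCharted (μS ((fun p => p + -y₀) '' Y)) := ShadowGluing.isCharted_μS h0 hud hgood₀
  have hch' : IsCharted (μS Y) := by
    simpa only [Set.image_image, neg_add_cancel_right, Set.image_id'] using isCharted_μS_translate y₀ hch
  exact exists_globalChart_of_isCharted hch'

/-- ★★★ **(CC)(σ) PROVED** — `PlacedCrystalChartP σ (10⁻⁴) 5` for every `σ > 2·10⁻⁴` (tree ZZZK `placedCrystalChartP_record` verbatim). [tree ZZZK, re-dialled g90] -/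
theorem placedCrystalChartP_sigma {σ : ℝ} (hσ : 2 * (1 / 10000 : ℝ) < σ) : PlacedCrystalChartP σ (1 / 10000) 5 := by
  intro H hH L' w' U t hsep hsh
  obtain ⟨Ψ, τ, hΨ, hsurj⟩ := exists_ontoChart_of_good_sigma (by linarith) hsep (layeredHom_good_of_shadow_sigma hσ hH hsep hsh) (base_mem_layeredHom L' w')
  have hd : ∀ y y', dist (U.symm (Ψ y) + t) (U.symm (Ψ y') + t) = dist (Ψ y) (Ψ y') := fun y y' => by
    rw [dist_add_right, U.symm.dist_map]
  refine ⟨fun y => U.symm (Ψ y) + t, τ, ⟨?_, ?_, ?_⟩, ?_⟩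
  · intro y _ y' _ h
    have h' : U.symm (Ψ y) + t = U.symm (Ψ y') + t := h
    exact hΨ.1 (Set.mem_univ y) (Set.mem_univ y') (U.symm.injective (add_right_cancel h'))
  · intro y _
    show U (U.symm (Ψ y) + t - t) ∈ LayeredHom L' w'
    simpa using hΨ.2.1 (Set.mem_univ y)
  · intro y _ y' _
    have e : IsBond (U.symm (Ψ y) + t) (U.symm (Ψ y') + t) ↔ IsBond (Ψ y) (Ψ y') := by simp only [IsBond, hd]
    exact e.trans (hΨ.2.2 y (Set.mem_univ y) y' (Set.mem_univ y'))
  · intro c hc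
    obtain ⟨x, hx⟩ := hsurj (U (c - t)) hc
    exact ⟨x, by simp [hx]⟩

/-- ★★ tree ZZZE `exists_isBondLabel_of_slabIso_record₂` at symbolic `σ` (`2·10⁻⁴ < σ` is the hypothesis `hσ` of tree ZZP `exists_isBondLabel_of_slabIso`). [tree ZZZE, re-dialled g90] -/
theorem exists_isBondLabel_of_slabIso_record₂_sigma {σ aHi δ : ℝ} (hσ : 2 * (1 / 10000 : ℝ) < σ) {S K H : Set E3}
    {L' : E3 →L[ℝ] E3} {w' : ℤ → E3} {U : E3 ≃ₗᵢ[ℝ] E3} {t : E3}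
    (haHi : aHi ≤ 1) (hS : IsDoorSetP aHi δ S)
    (hcr : IsCoolShadowCrystal σ (1 / 10000) 5 (1 / 10000) 8 10 (43 / 2) S K H L' w' U t)
    {Ψ : ℤ × ℤ × ℤ → E3} {τS : ℤ → Bool} (hΨ : IsBarlowBondChart S Set.univ Ψ τS) (hsurj : ∀ p ∈ S, ∃ x, Ψ x = p)
    (hfin : Set.Finite {x : ℤ × ℤ × ℤ | ∃ k ∈ K, dist (Ψ x) k ≤ 145 / 16})
    {Φ : ℤ × ℤ × ℤ → E3} {τC : ℤ → Bool} {D : Set (ℤ × ℤ × ℤ)}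
    (hΦ : IsBarlowBondChart (placedCrystal L' w' U t) D Φ τC)
    (hlc : ∀ y ∈ D, (∃ k ∈ K, dist (Φ y) k < 21 / 2) → ∀ y' : ℤ × ℤ × ℤ, BarlowAdj τC y y' → y' ∈ D)
    {Θ : ℤ × ℤ × ℤ → ℤ × ℤ × ℤ} {Kread : Set ℤ} (hK : ∀ x : ℤ × ℤ × ℤ, (∃ k ∈ K, dist (Ψ x) k ≤ 179 / 16) → x.1 ∈ Kread)
    (hX₁ : Function.Injective Θ)
    (hX₂ : ∀ x x' : ℤ × ℤ × ℤ, x.1 ∈ Kread → (BarlowAdj τS x x' ↔ BarlowAdj τC (Θ x) (Θ x')))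
    (hX₃ : ∀ y : ℤ × ℤ × ℤ, Ψ y ∈ moatIn S K (145 / 16) (43 / 2) → (∃ k ∈ K, dist (Ψ y) k < 13) →
      Θ y ∈ D ∧ dist (Ψ y) (Φ (Θ y)) ≤ 1 / 10000) :
    ∃ lab : E3 → E3, IsBondLabel (1 / 10000) (145 / 16) (43 / 2) S K (placedCrystal L' w' U t) lab :=
  exists_isBondLabel_of_slabIso (rI := 163 / 16) (RΘ := 13) haHi hS (by norm_num) (by norm_num)
    (hcr.mono le_rfl le_rfl le_rfl le_rfl (by norm_num) (by norm_num) le_rfl) hσ (by norm_num) (by norm_num) (by norm_num)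
    (by norm_num) hΨ hsurj hfin hΦ hlc hX₁ (fun x x' hx h => (hX₂ x x' hx).1 h) hX₃
    (fun x ⟨k, hk, hxk⟩ => hK x ⟨k, hk, hxk.trans (by norm_num)⟩)

/-- ★★ tree ZZZF `exists_isBondLabel₂_of_package` at symbolic `σ`. [tree ZZZF, re-dialled g90] -/
theorem exists_isBondLabel₂_of_package_sigma {σ aHi δ δS βS δC βC : ℝ} (hσ : 2 * (1 / 10000 : ℝ) < σ) {S K : Set E3} {H : Set E3}
    {L' : E3 →L[ℝ] E3} {w' : ℤ → E3} {U : E3 ≃ₗᵢ[ℝ] E3} {t : E3}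
    {D : Set (ℤ × ℤ × ℤ)} {Ψ Φ : ℤ × ℤ × ℤ → E3} {τS τC : ℤ → Bool} {x₀ : E3}
    (haHi : aHi ≤ 1) (hS : IsDoorSetP aHi δ S)
    (hcr : IsCoolShadowCrystal σ (1 / 10000) 5 (1 / 10000) 8 10 (43 / 2) S K H L' w' U t)
    (hΨ : IsBarlowBondChart S Set.univ Ψ τS) (hsurjΨ : ∀ p ∈ S, ∃ x, Ψ x = p)
    (hclean : ∀ p ∈ S, IsTwoShellGoodSet (1 / 16) (9 / 10) 1 S p)
    (hsepS : ∀ p ∈ S, ∀ p' ∈ S, p ≠ p' → δS ≤ dist p p') (hεS : 2 * (1 / 10000 : ℝ) < δS)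
    (hgapS : ∀ p ∈ S, ∀ p' ∈ S, IsBond p p' → dist p p' ≤ βS) (hβS : βS + 2 * (1 / 10000 : ℝ) ≤ 28 / 25) (hβS' : βS ≤ 17 / 16)
    (hΦ : IsBarlowBondChart (placedCrystal L' w' U t) D Φ τC)
    (hsepC : ∀ c ∈ placedCrystal L' w' U t, ∀ c' ∈ placedCrystal L' w' U t, c ≠ c' → δC ≤ dist c c') (hεC : 2 * (1 / 10000 : ℝ) < δC)
    (hgapC : ∀ c ∈ placedCrystal L' w' U t, ∀ c' ∈ placedCrystal L' w' U t, IsBond c c' → dist c c' ≤ βC)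
    (hβC : βC + 2 * (1 / 10000 : ℝ) ≤ 28 / 25)
    (hlc : ∀ y ∈ D, (∃ k ∈ K, dist (Φ y) k < 21 / 2) → ∀ y' : ℤ × ℤ × ℤ, BarlowAdj τC y y' → y' ∈ D)
    (hKS : K ⊆ S) (hKfin : K.Finite) (hKne : K.Nonempty) (hK : ∀ k ∈ K, dist k x₀ ≤ 4)
    (hout : ∀ p ∈ moatIn S K 8 (43 / 2), ∃ y ∈ D, dist p (Φ y) ≤ 1 / 10000)
    (hfin : Set.Finite {x : ℤ × ℤ × ℤ | ∃ k ∈ K, dist (Ψ x) k ≤ 43 / 2})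
    (hR1 : WindowConnected S K Ψ τS) (hR2S : LayerCovered S K Ψ) (hR2C : ReadCovered S K D Ψ Φ (1 / 10000)) :
    ∃ lab : E3 → E3, IsBondLabel (1 / 10000) (145 / 16) (43 / 2) S K (placedCrystal L' w' U t) lab := by
  obtain ⟨Θ, Kread, Φ'', τ'', D'', hΦ'', hlc'', hinj, hiso, hpart, hKread⟩ :=
    slabIso_package_reg hΨ hsurjΨ hclean hsepS hεS hgapS hβS hβS' hΦ hsepC hεC hgapC hβC (by norm_num) hlc hKS hKfin hKne hK hout
      hfin hR1 hR2S hR2C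
  have hfin' : Set.Finite {x : ℤ × ℤ × ℤ | ∃ k ∈ K, dist (Ψ x) k ≤ 145 / 16} :=
    hfin.subset fun x ⟨k, hk, hxk⟩ => ⟨k, hk, hxk.trans (by norm_num)⟩
  exact exists_isBondLabel_of_slabIso_record₂_sigma hσ haHi hS hcr hΨ hsurjΨ hfin' hΦ'' hlc'' hKread hinj hiso hpart

/-- ★★ tree ZZZG `bondLabelP₂_of_placedCrystalChartP` at symbolic `σ`: **(GL₂)(σ) ⟸ (CC)(σ)**, `2·10⁻⁴ < σ`. [tree ZZZG, re-dialled g90] -/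
theorem bondLabelP₂_of_placedCrystalChartP_sigma {σ : ℝ} (hσ : 2 * (1 / 10000 : ℝ) < σ) (hCC : PlacedCrystalChartP σ (1 / 10000) 5) (ϑc : ℝ) :
    BondLabelP₂ ϑc (1 / 10) 8 (145 / 16) 4 12 16 σ (1 / 10000) 5 (1 / 10000) 10 (43 / 2) 1 2 (1 / 16) (1 / 50) := by
  intro δ hδ a ha S hS hsum hgood L w hL x₀ K hKS hKq hTp hTc L' w' U t hcr
  -- the corner `K = ∅`
  rcases K.eq_empty_or_nonempty with rfl | hKne
  · exact ⟨id, isBondLabel_empty _ _ _ _ _⟩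
  -- the C-chart from (CC): clean chart crystal `hL.2.2.2.1`, separation (ii) and shadow (iii) of the cool shadow crystal
  obtain ⟨Φ, τC, hΦ, hsurjΦ⟩ := hCC _ hL.2.2.2.1 L' w' U t hcr.2.1 hcr.2.2.1
  -- the S-chart and the S-side facts of a door set
  obtain ⟨Ψ, τS, hΨ, hsurjΨ⟩ := exists_globalChart_of_isCharted hS.2.2.2.2
  have hclean : ∀ p ∈ S, IsTwoShellGoodSet (1 / 16) (9 / 10) 1 S p := fun p hp => isTwoShellGoodSet_of_isDoorSetP hS hp
  have hsepS : IsSep (27 / 32) S := isSep_of_isDoorSetP le_rfl hS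
  have hgapS : ∀ p ∈ S, ∀ p' ∈ S, IsBond p p' → dist p p' ≤ 17 / 16 := fun p hp p' hp' hb => by
    have h := ((isBond_iff_of_isDoorSetP le_rfl hS hp hp').1 hb).2
    linarith
  -- the C-side facts of a cool shadow crystal
  have hsepC : IsSep σ (placedCrystal L' w' U t) := isSep_placedCrystal U t hcr.2.1
  have hgapC : ∀ c ∈ placedCrystal L' w' U t, ∀ c' ∈ placedCrystal L' w' U t, IsBond c c' →
      dist c c' ≤ 17 / 16 + 2 * (1 / 10000) := fun c hc c' hc' hb =>
    placedCrystal_gap hL.2.2.2.1 hcr (by norm_num) (by norm_num) hc hc' hb.2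
  -- the container is finite; the charted sites near it are finitely many on both sides
  have hKfin : K.Finite :=
    (finite_inter_of_separated hδ hS.2.1 (isCompact_closedBall x₀ 4)).subset fun k hk => ⟨mem_closedBall.2 (hKq k hk), hKS hk⟩
  have hfin : Set.Finite {x : ℤ × ℤ × ℤ | ∃ k ∈ K, dist (Ψ x) k ≤ 43 / 2} :=
    finite_chartSites_near_univ (by norm_num) hsepS hΨ hKq
  have hfinC : Set.Finite {y : ℤ × ℤ × ℤ | y ∈ (Set.univ : Set (ℤ × ℤ × ℤ)) ∧ ∃ k ∈ K, dist (Φ y) k ≤ 43 / 2} :=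
    finite_chartSites_near (by linarith) hsepC hΦ hKq
  -- link closure is free on `D = univ`
  have hlc43 : ∀ y ∈ (Set.univ : Set (ℤ × ℤ × ℤ)), (∃ k ∈ K, dist (Φ y) k < 43 / 2) → ∀ y' : ℤ × ℤ × ℤ,
      BarlowAdj τC y y' → y' ∈ (Set.univ : Set (ℤ × ℤ × ℤ)) := fun _ _ _ y' _ => mem_univ y'
  have hlc : ∀ y ∈ (Set.univ : Set (ℤ × ℤ × ℤ)), (∃ k ∈ K, dist (Φ y) k < 21 / 2) → ∀ y' : ℤ × ℤ × ℤ,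
      BarlowAdj τC y y' → y' ∈ (Set.univ : Set (ℤ × ℤ × ℤ)) := fun _ _ _ y' _ => mem_univ y'
  -- REG-out partners are charted sites (the chart is onto)
  have hout : ∀ p ∈ moatIn S K 8 (43 / 2), ∃ y ∈ (Set.univ : Set (ℤ × ℤ × ℤ)), dist p (Φ y) ≤ 1 / 10000 := fun p hp => by
    obtain ⟨c, hc, hpc⟩ := hcr.2.2.2.1 p hp.1 hp.2.1 hp.2.2
    obtain ⟨y, rfl⟩ := hsurjΦ c hc
    exact ⟨y, mem_univ y, hpc⟩
  -- the three riders
  have hR1 : WindowConnected S K Ψ τS := windowConnected hΨ hsurjΨ hclean hKfin hKne hKq hfin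
  have hR2S : LayerCovered S K Ψ := layerCovered hΨ hKne hfin
  have hR2C : ReadCovered S K Set.univ Ψ Φ (1 / 10000) := readCovered hΦ hlc43 hcr.2.2.2.2 hsurjΨ hKne hfinC (by norm_num)
  exact exists_isBondLabel₂_of_package_sigma hσ le_rfl hS hcr hΨ hsurjΨ hclean hsepS (by norm_num) hgapS (by norm_num) le_rfl hΦ hsepC
    hσ hgapC (by norm_num) hlc hKS hKfin hKne hKq hout hfin hR1 hR2S hR2C

/-- ★★★ **(GL₂)(σ) UNCONDITIONALLY**, every `σ > 2·10⁻⁴`, every `ϑc`. [tree ZZZK, re-dialled g90] -/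
theorem bondLabelP₂_sigma {σ : ℝ} (hσ : 2 * (1 / 10000 : ℝ) < σ) (ϑc : ℝ) :
    BondLabelP₂ ϑc (1 / 10) 8 (145 / 16) 4 12 16 σ (1 / 10000) 5 (1 / 10000) 10 (43 / 2) 1 2 (1 / 16) (1 / 50) :=
  bondLabelP₂_of_placedCrystalChartP_sigma hσ (placedCrystalChartP_sigma hσ) ϑc

end SigmaGL

/-! ### ZZZYA-2  (UXᴸ)(σ): the label chain at symbolic shadow separation `σ ≥ 1/2` -/

section SigmaChain

/-- ★★★ tree ZZZV `labelChain_exit` VERBATIM at symbolic `σ` — `σ` enters the proof only through `bonded_placed_le_twelve` (`1/2 ≤ σ`). [tree ZZZV, re-dialled g90] -/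
theorem labelChain_exit_sigma {σ ϑc ϑp r rΘ q rsh ρ rm ε rI ℓ Rg sb dB Λ θ s : ℝ} (hσ : 1 / 2 ≤ σ)
    (hq : q ≤ rΘ) (hq2 : q ^ 2 ≤ 2 * rΘ) (hqr : q + rΘ ≤ 14) (hρ : rΘ + 5 ≤ ρ) (hρℓ : ρ < ℓ) (hRg : 23 / 5 ≤ Rg) (hsb : 0 ≤ sb)
    (hsb7 : 7 * sb ≤ 7 / 20) (hdB : ε + 7 * sb ≤ dB) :
    ∀ δ : ℝ, 0 < δ → ∀ a : ℝ, 0 < a →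
      ∀ S : Set E3, IsDoorSetP 1 δ S → (∀ z : E3, Summable fun y : S => lennardJones (dist z (y : E3))) →
        (∀ p ∈ S, IsTwoShellAffineGood θ S p) →
          ∀ (L : E3 ≃L[ℝ] E3) (w : ℤ → E3), IsEquilChart a s Λ L w →
            ∀ (x₀ : E3) (K : Set E3), K ⊆ S → (∀ k ∈ K, dist k x₀ ≤ q) →
              IsTameOn ϑp S (LayeredHom (L : E3 →L[ℝ] E3) w) (coreOf S K rm) →
                IsTameOn ϑc S (LayeredHom (L : E3 →L[ℝ] E3) w) (moatIn S K r (r + rsh)) →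
                  ∀ (n : ℕ) (xf : Fin n → E3), Function.Injective xf → Set.range xf = coreOf S K ρ →
                    ∀ (L' : E3 →L[ℝ] E3) (w' : ℤ → E3) (U : E3 ≃ₗᵢ[ℝ] E3) (t : E3),
                      IsCoolShadowCrystal σ (1 / 10000) 5 ε r rI ℓ S K (LayeredHom (L : E3 →L[ℝ] E3) w) L' w' U t →
                        ∀ lab : E3 → E3, IsBondLabel ε rΘ ℓ S K (placedCrystal L' w' U t) lab →
                          ∀ i : Fin n, dB < dist (xf i) (lab (xf i)) →
                            ∃ i' j' : Fin n, i' ≠ j' ∧ dist (lab (xf i')) (lab (xf j')) ≤ Rg ∧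
                              sb < dist (xf i' - xf j') (lab (xf i') - lab (xf j')) := by
  intro δ hδ a ha S hS hsum hgood L w hLw x₀ K hKS hKq hmild hcool n xf hxf hrange L' w' U t hSC lab hlab i hfar
  by_contra hno
  push Not at hno
  set H : Set E3 := LayeredHom (L : E3 →L[ℝ] E3) w with hHdef
  set C : Set E3 := placedCrystal L' w' U t with hCdef
  set p₀ : E3 := xf i with hp₀def
  set e₀ : E3 := p₀ - lab p₀ with he₀def
  -- constants
  set R₀ : ℝ := rΘ + 6 / 5 with hR₀def
  set R₁ : ℝ := R₀ + 19 / 10 with hR₁def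
  -- (★) the no-hop hypothesis on core sites
  have hstar : ∀ p ∈ coreOf S K ρ, ∀ p' ∈ coreOf S K ρ, dist (lab p) (lab p') ≤ Rg → ‖(p - lab p) - (p' - lab p')‖ ≤ sb := by
    intro p hp p' hp' hd
    rw [← hrange] at hp hp'
    obtain ⟨i', rfl⟩ := hp
    obtain ⟨j', rfl⟩ := hp'
    by_cases hij : i' = j'
    · subst hij; rw [sub_self, norm_zero]; exact hsb
    · have h := hno i' j' hij hd
      rw [dist_eq_norm] at h
      have e : xf i' - xf j' - (lab (xf i') - lab (xf j')) = (xf i' - lab (xf i')) - (xf j' - lab (xf j')) := by abel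
      rwa [e] at h
  -- the chart crystal is clean, so the shadow crystal supplies descent steps and has ≤ 12 bonded sites per site
  have hH : ∀ x ∈ H, IsTwoShellGoodSet (1 / 16) (9 / 10) 1 H x := by
    intro x hx
    have hcl := hLw.2.2.2.1
    have h := hcl x ((mem_iff_μS_singleton_ne_zero H x).2 hx)
    rwa [setOf_μS_ne_zero] at h
  have hstep : ∀ c ∈ C, ∀ g : E3, ∃ a : ℝ, 9 / 10 ≤ a ∧ a ≤ 1 ∧ ∃ c' ∈ C, ∃ y : E3,
      dist c' y ≤ a / 16 + 1 / 10000 ∧ dist y c = a ∧ dist y (c + g) ^ 2 ≤ ‖g‖ ^ 2 - Real.sqrt 2 * a * ‖g‖ + a ^ 2 :=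
    fun c hc g => shadow_descent_step hSC hH (by norm_num) hc g
  have hB : ∀ c ∈ C, ({c' | c' ∈ C ∧ IsBond c c'}).ncard ≤ 12 ∧ ({c' | c' ∈ C ∧ IsBond c c'}).Finite :=
    fun c hc => bonded_placed_le_twelve hSC hH (by norm_num) (by norm_num) hσ hc
  -- the far site is a hot core atom
  have hp₀core : p₀ ∈ coreOf S K ρ := by rw [← hrange]; exact Set.mem_range_self i
  have hp₀S : p₀ ∈ S := hp₀core.1
  have hρ0 : 0 ≤ ρ := by obtain ⟨-, k, -, hk⟩ := hp₀core; exact dist_nonneg.trans hk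
  have hreg := hlab.2.2.2
  obtain ⟨k₁, hk₁K, hk₁⟩ : ∃ k₁ ∈ K, dist p₀ k₁ ≤ rΘ := by
    by_contra h
    push Not at h
    have hz : ∃ k ∈ K, dist p₀ k < ℓ := by obtain ⟨-, k, hk, hkd⟩ := hp₀core; exact ⟨k, hk, by linarith⟩
    have := hreg p₀ hp₀S hz h
    linarith
  -- the exit direction
  obtain ⟨u₁, hu₁⟩ := exists_norm_eq E3 zero_le_one
  set D : ℝ := ‖p₀ - x₀‖ with hDdef
  have hD0 : 0 ≤ D := norm_nonneg _
  obtain ⟨u, hu, hDu⟩ : ∃ u : E3, ‖u‖ = 1 ∧ p₀ - x₀ = D • u := by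
    by_cases h0 : p₀ - x₀ = 0
    · refine ⟨u₁, hu₁, ?_⟩; rw [hDdef, h0, norm_zero, zero_smul]
    · refine ⟨D⁻¹ • (p₀ - x₀), ?_, ?_⟩
      · rw [norm_smul, norm_inv, norm_norm, inv_mul_cancel₀ (norm_ne_zero_iff.2 h0)]
      · rw [smul_smul, mul_inv_cancel₀ (norm_ne_zero_iff.2 h0), one_smul]
  -- the far core site `kᵤ` in direction `u`
  have hKcore : K ⊆ coreOf S K ρ := fun k hk => ⟨hKS hk, k, hk, by rw [dist_self]; exact hρ0⟩
  have hKfin : K.Finite := by rw [← hrange] at hKcore; exact (Set.finite_range xf).subset hKcore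
  obtain ⟨kᵤ, hkᵤK, hkmax⟩ := Set.exists_max_image K (fun k => ⟪k, u⟫) hKfin ⟨k₁, hk₁K⟩
  have hkᵤS : kᵤ ∈ S := hKS hkᵤK
  -- geometry of the start, the exit vector and the segment
  have hstart : dist p₀ kᵤ ≤ R₀ := by
    have h1 := labelChain_start_sq hu hDu hD0 hk₁ (hkmax k₁ hk₁K) (hKq kᵤ hkᵤK)
    have hrΘ : 0 ≤ rΘ := dist_nonneg.trans hk₁
    have h2 : dist p₀ kᵤ ^ 2 ≤ R₀ ^ 2 := by rw [hR₀def]; nlinarith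
    have h' := Real.sqrt_le_sqrt h2
    rwa [Real.sqrt_sq dist_nonneg, Real.sqrt_sq (by linarith)] at h'
  set z : E3 := kᵤ + R₀ • u with hzdef
  set V : E3 := z - p₀ with hVdef
  have hDle : D ≤ 2 * R₀ := by
    have h1 : D ≤ dist p₀ k₁ + dist k₁ x₀ := by rw [hDdef, ← dist_eq_norm]; exact dist_triangle _ _ _
    have h2 := hKq k₁ hk₁K
    rw [hR₀def]; linarith
  have hV : ‖V‖ ≤ 63 / 4 := by
    have h := labelChain_exit_norm (lam := R₀) hu hDu hD0 hDle (hKq kᵤ hkᵤK)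
    rw [hVdef, hzdef, hR₀def] at *; linarith
  have hzk : dist z kᵤ ≤ R₀ := by
    rw [hzdef, dist_eq_norm, add_sub_cancel_left, norm_smul, hu, mul_one, Real.norm_eq_abs, abs_of_nonneg (by rw [hR₀def]; linarith [dist_nonneg.trans hk₁])]
  -- way-points
  set tw : ℕ → E3 := fun j => lab p₀ + ((j : ℝ) / 21) • V with htwdef
  have htw : ∀ j, tw j = lab p₀ + ((j : ℝ) / 21) • V := fun j => rfl
  have hballj : ∀ j : ℕ, j ≤ 21 → dist (tw j + e₀) kᵤ ≤ R₀ := by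
    intro j hj
    have e : tw j + e₀ = p₀ + ((j : ℝ) / 21) • (z - p₀) := by rw [htw, he₀def, hVdef]; abel
    rw [e]
    have hj' : (j : ℝ) ≤ 21 := by exact_mod_cast hj
    exact labelChain_segment_ball hstart hzk (by positivity) (by rw [div_le_one (by norm_num : (0:ℝ) < 21)]; exact hj')
  -- the chain context
  have hR₁ℓ : R₁ + 17 / 16 < ℓ := by rw [hR₁def, hR₀def]; linarith
  have hlabC : ∀ p ∈ S, dist p kᵤ ≤ R₁ → lab p ∈ C := fun p hp hpk => hlab.1 p hp ⟨kᵤ, hkᵤK, by linarith⟩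
  have hlift : ∀ p ∈ S, dist p kᵤ ≤ R₁ → ∀ c' ∈ C, IsBond (lab p) c' → ∃ p' ∈ S, dist p p' ≤ 17 / 16 ∧ lab p' = c' := by
    intro p hp hpk c' hc' hb
    obtain ⟨p', hp'S, -, hd, hl⟩ := exists_contact_of_bonded_label hS hlab hB hp ⟨kᵤ, hkᵤK, by linarith⟩ hc' hb
    exact ⟨p', hp'S, hd, hl⟩
  have hcoreR : ∀ p ∈ S, dist p kᵤ ≤ R₁ + 17 / 16 → p ∈ coreOf S K ρ := fun p hp hpk =>
    ⟨hp, kᵤ, hkᵤK, by rw [hR₁def, hR₀def] at hpk; linarith⟩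
  have hR₁ : R₀ + 19 / 10 ≤ R₁ := le_of_eq hR₁def.symm
  have hp₀k : dist p₀ kᵤ ≤ R₁ := by linarith
  -- run the chain: seven blocks
  obtain ⟨pe, hpeS, hpek, hpet, hpee⟩ := labelChain_blocks (core := coreOf S K ρ) tw htw hV hstep le_rfl hlabC hlift hcoreR hstar hRg hsb
    hsb7 hR₁ he₀def hp₀S hp₀k hballj 7 le_rfl
  -- the end atom is near the exit point, hence cool and registered
  have htw21 : tw 21 + e₀ = z := by
    rw [htw, he₀def, hVdef, show ((21 : ℕ) : ℝ) / 21 = 1 by norm_num, one_smul]; abel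
  have hpez : dist pe z ≤ 4 / 5 + 7 * sb := by
    have e : pe - z = (lab pe - tw (3 * 7)) + ((pe - lab pe) - e₀) := by rw [← htw21, show 3 * 7 = 21 by rfl]; abel
    rw [dist_eq_norm, e]
    have := norm_add_le (lab pe - tw (3 * 7)) ((pe - lab pe) - e₀)
    rw [← dist_eq_norm] at this
    push_cast at hpee
    linarith
  have hcoolpe : ∀ k ∈ K, rΘ < dist pe k := by
    intro k hk
    have h := labelChain_cap_far hu (hkmax k hk) hzdef hpez
    rw [hR₀def] at h; linarith
  have hpez' : ∃ k ∈ K, dist pe k < ℓ := ⟨kᵤ, hkᵤK, by linarith⟩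
  have hpe_reg : dist pe (lab pe) ≤ ε := hreg pe hpeS hpez' hcoolpe
  -- conclusion: `‖e₀‖ ≤ ε + 7 sb ≤ dB`
  have he₀ : ‖e₀‖ ≤ ε + 7 * sb := by
    have e : e₀ = (pe - lab pe) - ((pe - lab pe) - e₀) := by abel
    have h1 := norm_sub_le (pe - lab pe) ((pe - lab pe) - e₀)
    have h2 : ‖pe - lab pe‖ ≤ ε := by rw [← dist_eq_norm]; exact hpe_reg
    rw [e]
    push_cast at hpee
    linarith
  rw [he₀def, ← dist_eq_norm] at he₀
  linarith

/-- ★★★ (UXᴸ)(σ) in the label-chain regime (tree ZZZV `offTubeBulkExitP_of_labelChain`). [tree ZZZV, re-dialled g90] -/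
theorem offTubeBulkExitP_of_labelChain_sigma {σ ϑc ϑp r rΘ q rsh ρ rm ε rI ℓ Rg sb dB Λ θ s : ℝ} (hσ : 1 / 2 ≤ σ)
    (hq : q ≤ rΘ) (hq2 : q ^ 2 ≤ 2 * rΘ) (hqr : q + rΘ ≤ 14) (hρ : rΘ + 5 ≤ ρ) (hρℓ : ρ < ℓ) (hRg : 23 / 5 ≤ Rg) (hsb : 0 ≤ sb)
    (hsb7 : 7 * sb ≤ 7 / 20) (hdB : ε + 7 * sb ≤ dB) :
    OffTubeBulkExitP ϑc ϑp r rΘ q rsh ρ rm σ (1 / 10000) 5 ε rI ℓ Rg sb dB 1 Λ θ s :=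
  labelChain_exit_sigma hσ hq hq2 hqr hρ hρℓ hRg hsb hsb7 hdB

/-- ★★★ (UXᴸ)(σ)_fat (tree ZZZV `offTubeBulkExitP_fat`). [tree ZZZV, re-dialled g90] -/
theorem offTubeBulkExitP_fat_sigma {σ ϑc : ℝ} (hσ : 1 / 2 ≤ σ) :
    OffTubeBulkExitP ϑc (1 / 10) 8 (145 / 16) 4 12 16 16 σ (1 / 10000) 5 (1 / 10000) 10 (43 / 2) (121 / 25) (249 / 5000) (21 / 50) 1 2
      (1 / 16) (1 / 50) :=
  offTubeBulkExitP_of_labelChain_sigma hσ (by norm_num) (by norm_num) (by norm_num) (by norm_num) (by norm_num) (by norm_num) (by norm_num) (by norm_num)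
    (by norm_num)

/-- ★★ (BXᴸ)(σ)_fat ⟸ (UXᴸ)(σ)_fat (tree ZZZU `offTubeBondExitP_fat`). [tree ZZZU, re-dialled g90] -/
theorem offTubeBondExitP_fat_sigma {σ ϑc : ℝ}
    (hUX : OffTubeBulkExitP ϑc (1 / 10) 8 (145 / 16) 4 12 16 16 σ (1 / 10000) 5 (1 / 10000) 10 (43 / 2)
      (121 / 25) (249 / 5000) (21 / 50) 1 2 (1 / 16) (1 / 50)) :
    OffTubeBondExitP ϑc (1 / 10) 8 (145 / 16) 4 12 16 16 σ (1 / 10000) 5 (1 / 10000) 10 (43 / 2)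
      (121 / 25) (249 / 5000) (249 / 5000) (21 / 50) 1 2 (1 / 16) (1 / 50) :=
  offTubeBondExitP_of_bulkExit (by norm_num) (by norm_num) (by norm_num) (by norm_num) hUX

/-- ★★★ (TGᴸ)(σ)(m₀ = 10⁻⁴)_fat ⟸ (BXᴸ)(σ)_fat (tree ZZZU `offTubeRigidGapP_fat`; `σ` is not read by the motion dichotomy). [tree ZZZU, re-dialled g90] -/
theorem offTubeRigidGapP_fat_sigma {σ ϑc sb₁ dI₁ dB₁ : ℝ} (hsb : 4 * sb₁ ≤ 249 / 5000) (hdI : 4 * dI₁ ≤ 249 / 5000)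
    (hBX : OffTubeBondExitP ϑc (1 / 10) 8 (145 / 16) 4 12 16 16 σ (1 / 10000) 5 (1 / 10000) 10 (43 / 2)
      (121 / 25) (249 / 5000) (249 / 5000) (21 / 50) 1 2 (1 / 16) (1 / 50)) :
    OffTubeRigidGapP ϑc (1 / 10) 8 (145 / 16) 4 12 16 16 σ (1 / 10000) 5 (1 / 10000) 10 (43 / 2)
      (121 / 25) (249 / 5000) (249 / 5000) (21 / 50) sb₁ dI₁ dB₁ (1 / 10000) 1 2 (1 / 16) (1 / 50) := by
  have hX : 31 / 2000 ≤ 249 / 5000 - sb₁ - 9 / 2000 * (121 / 25 + sb₁) := by linarith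
  have hY : 21 / 1000 ≤ 1433 / 100 * (9 / 2000) - 2 * (17321 / 10000) * (1 / 10000 + dI₁) := by linarith
  exact offTubeRigidGapP_of_bondExit (κ := 9 / 2000) (tF := 1433 / 100) (uF := 17321 / 10000) (rC := 15) (by norm_num) (by norm_num) (by norm_num)
    (by norm_num) (by norm_num) (by norm_num) (by norm_num) (by norm_num) (by norm_num) (by norm_num) (by norm_num) (by linarith) (by linarith)
    (by nlinarith) (by nlinarith) hBX

end SigmaChain

end Summit.AtomisticToContinuum.Crystallization.Theorems.ChartedZeroExcessLayeredLatticeLiouville
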